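import Mathlib.Geometry.Manifold.ChartedSpace
import Mathlib.Analysis.InnerProductSpace.PiL2
import Mathlib.AlgebraicTopology.FundamentalGroupoid.SimplyConnected
import Mathlib.Data.ZMod.Basic
import Summits.Ventures.HodgeRepro2.HostAPI.Carriers.AlgebraicTopology.SingularHomology.RelativeHomology
import Summits.Ventures.HodgeRepro2.HostAPI.Util.ForallBinderLint
open HostAPI.Carriers

noncomputable section

open CategoryTheory Limits Topology

universe u v

namespace HostAPI.Carriers.AlgebraicTopology.SingularHomology

variable (R : Type v) [CommRing R] (M : Type v) [AddCommGroup M] [Module R M]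
variable {X Y Z : Type u} [TopologicalSpace X] [TopologicalSpace Y] [TopologicalSpace Z]

variable (X) in

abbrev localHomologyOfSet (K : Set X) (n : ℕ) : ModuleCat.{max u v} R :=
  relativeSingularHomology R M X Kᶜ n

variable (X) in

abbrev localHomology (x : X) (n : ℕ) : ModuleCat.{max u v} R :=
  localHomologyOfSet R M X {x} n

def restrictLocal {K L : Set X} (h : L ⊆ K) (n : ℕ) :
    localHomologyOfSet R M X K n ⟶ localHomologyOfSet R M X L n :=
  relativeSingularHomology.map R M (ContinuousMap.id X) (fun _ hx ↦ Set.compl_subset_compl.2 h hx) n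

abbrev restrictToPoint {K : Set X} {x : X} (hx : x ∈ K) (n : ℕ) :
    localHomologyOfSet R M X K n ⟶ localHomology R M X x n :=
  restrictLocal R M (Set.singleton_subset_iff.2 hx) n

@[simp]
lemma restrictLocal_self (K : Set X) (n : ℕ) : restrictLocal R M (subset_refl K) n = 𝟙 _ :=
  relativeSingularHomology.map_id R M Kᶜ n

@[reassoc (attr := simp)]
lemma restrictLocal_comp {K L N : Set X} (hLK : L ⊆ K) (hNL : N ⊆ L) (n : ℕ) :
    restrictLocal R M hLK n ≫ restrictLocal R M hNL n = restrictLocal R M (hNL.trans hLK) n := by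
  rw [restrictLocal, restrictLocal, ← relativeSingularHomology.map_comp]
  rfl

namespace localHomology

def mapIso (e : X ≃ₜ Y) (x : X) (n : ℕ) : localHomology R M X x n ≅ localHomology R M Y (e x) n where
  hom := relativeSingularHomology.map R M (e : C(X, Y))
    (show Set.MapsTo e {x}ᶜ {e x}ᶜ from
      fun y hy h ↦ hy (e.injective (Set.mem_singleton_iff.1 h))) n
  inv := relativeSingularHomology.map R M (e.symm : C(Y, X))
    (show Set.MapsTo e.symm {e x}ᶜ {x}ᶜ from
      fun y hy h ↦ hy (by rw [Set.mem_singleton_iff] at h ⊢; rw [← h, e.apply_symm_apply])) n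
  hom_inv_id := by
    rw [← relativeSingularHomology.map_comp, ← relativeSingularHomology.map_id]
    congr 1
    ext
    simp
  inv_hom_id := by
    rw [← relativeSingularHomology.map_comp, ← relativeSingularHomology.map_id]
    congr 1
    ext
    simp

end localHomology

def nonempty_localHomology_iso : Prop :=
  ∀ {n : ℕ} [T2Space X] [ChartedSpace (EuclideanSpace ℝ (Fin n)) X] (x : X),
    Nonempty (localHomology R R X x n ≅ ModuleCat.of R (ULift.{u} R))

def isZero_localHomology : Prop :=
  ∀ {n : ℕ} [T2Space X] [ChartedSpace (EuclideanSpace ℝ (Fin n)) X] (x : X) {k : ℕ} (hk : k ≠ n),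
    IsZero (localHomology R M X x k)

@[ext]
structure HomologicalOrientation (R : Type v) [CommRing R] (X : Type u) [TopologicalSpace X]
    (n : ℕ) where

  localClass : ∀ x : X, localHomology R R X x n

  isGenerator : ∀ x : X, ∃ e : localHomology R R X x n ≃ₗ[R] R, e (localClass x) = 1

  locallyConsistent : ∀ x : X, ∃ K ∈ 𝓝 x, ∃ μK : localHomologyOfSet R R X K n,
    ∀ y (hy : y ∈ K), restrictToPoint R R hy n μK = localClass y

namespace HomologicalOrientation

variable {R} {n : ℕ}

protected def neg (μ : HomologicalOrientation R X n) : HomologicalOrientation R X n where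
  localClass x := -μ.localClass x
  isGenerator x := by
    obtain ⟨e, he⟩ := μ.isGenerator x
    exact ⟨e.trans (LinearEquiv.neg R), by simp [he]⟩
  locallyConsistent x := by
    obtain ⟨K, hK, μK, hμK⟩ := μ.locallyConsistent x
    exact ⟨K, hK, -μK, fun y hy ↦ by rw [map_neg, hμK y hy]⟩

instance : Neg (HomologicalOrientation R X n) := ⟨HomologicalOrientation.neg⟩

@[simp]
lemma neg_localClass (μ : HomologicalOrientation R X n) (x : X) :
    (-μ).localClass x = -μ.localClass x := rfl

instance : InvolutiveNeg (HomologicalOrientation R X n) where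
  neg_neg μ := by ext x; simp

def comap (μ : HomologicalOrientation R X n) (e : Y ≃ₜ X) : HomologicalOrientation R Y n where
  localClass y := (localHomology.mapIso R R e y n).inv (μ.localClass (e y))
  isGenerator y := by
    obtain ⟨f, hf⟩ := μ.isGenerator (e y)
    refine ⟨(localHomology.mapIso R R e y n).toLinearEquiv.trans f, ?_⟩
    simp only [LinearEquiv.trans_apply, Iso.toLinearEquiv_apply]
    rw [← ModuleCat.comp_apply, Iso.inv_hom_id, ModuleCat.id_apply, hf]
  locallyConsistent y := by
    obtain ⟨K, hK, μK, hμK⟩ := μ.locallyConsistent (e y)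
    refine ⟨e ⁻¹' K, e.continuous.continuousAt.preimage_mem_nhds hK,
      relativeSingularHomology.map R R (e.symm : C(X, Y))
        (show Set.MapsTo e.symm Kᶜ (e ⁻¹' K)ᶜ from fun z hz h ↦ hz (by simpa using h)) n μK,
      fun z hz ↦ ?_⟩
    rw [← hμK (e z) hz, localHomology.mapIso, restrictToPoint, restrictLocal, restrictToPoint,
      restrictLocal, ← ModuleCat.comp_apply, ← ModuleCat.comp_apply,
      ← relativeSingularHomology.map_comp, ← relativeSingularHomology.map_comp]
    rfl

@[simp]
lemma comap_localClass (μ : HomologicalOrientation R X n) (e : Y ≃ₜ X) (y : Y) :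
    (μ.comap e).localClass y = (localHomology.mapIso R R e y n).inv (μ.localClass (e y)) := rfl

end HomologicalOrientation

variable (X) in

def IsOrientableOver (n : ℕ) : Prop :=
  Nonempty (HomologicalOrientation R X n)

def isOrientableOver_zmod_two : Prop :=
  ∀ {n : ℕ} [T2Space X] [ChartedSpace (EuclideanSpace ℝ (Fin n)) X],
    IsOrientableOver (ZMod 2) X n

def isOrientableOver_int_of_simplyConnectedSpace : Prop :=
  ∀ {n : ℕ} [T2Space X] [ChartedSpace (EuclideanSpace ℝ (Fin n)) X] [SimplyConnectedSpace X],
    IsOrientableOver ℤ X n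

def HomologicalOrientation.ext_of_connected : Prop :=
  ∀ {n : ℕ} [T2Space X] [ChartedSpace (EuclideanSpace ℝ (Fin n)) X] [ConnectedSpace X] (μ ν : HomologicalOrientation R X n) (x : X) (h : μ.localClass x = ν.localClass x),
    μ = ν

def HomologicalOrientation.eq_or_eq_neg_of_connected : Prop :=
  ∀ {n : ℕ} [T2Space X] [ChartedSpace (EuclideanSpace ℝ (Fin n)) X] [ConnectedSpace X] (μ ν : HomologicalOrientation ℤ X n),
    μ = ν ∨ μ = -ν

def isOrientableOver_of_int : Prop :=
  ∀ {n : ℕ} [T2Space X] [ChartedSpace (EuclideanSpace ℝ (Fin n)) X] (h : IsOrientableOver ℤ X n),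
    IsOrientableOver R X n

open unitInterval

abbrev complInclusion {K L : Set X} (h : L ⊆ K) : C((Kᶜ : Set X), (Lᶜ : Set X)) :=
  subsetRestrict (ContinuousMap.id X) (fun _ hx ↦ Set.compl_subset_compl.2 h hx)

theorem isIso_restrictLocal_of_retract {K L : Set X} (h : L ⊆ K)
    (ρ : C((Lᶜ : Set X), (Kᶜ : Set X))) (h₁ : ρ.comp (complInclusion h) = ContinuousMap.id _)
    (h₂ : ((complInclusion h).comp ρ).Homotopic (ContinuousMap.id _)) (n : ℕ) :
    IsIso (restrictLocal R M h n) := by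
  have hS₁ := relativeSingularChainComplex.shortExact_subsetι_π R M X Kᶜ
  have hS₂ := relativeSingularChainComplex.shortExact_subsetι_π R M X Lᶜ
  have hKL : Set.MapsTo (ContinuousMap.id X) Kᶜ Lᶜ := fun _ hx ↦ Set.compl_subset_compl.2 h hx
  let φ := relativeSingularChainComplex.shortComplexMap R M (ContinuousMap.id X) hKL
  have hτ₁ : ∀ k, IsIso (HomologicalComplex.homologyMap φ.τ₁ k) := fun k ↦ by
    change IsIso (singularHomology.map R M (complInclusion h) k)
    refine ⟨⟨singularHomology.map R M ρ k, ?_, ?_⟩⟩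
    · rw [← singularHomology.map_comp, h₁, singularHomology.map_id]
    · rw [← singularHomology.map_comp, singularHomology.map_eq_of_homotopic R M h₂,
        singularHomology.map_id]
  have hτ₂ : ∀ k, IsIso (HomologicalComplex.homologyMap φ.τ₂ k) := fun k ↦ by
    change IsIso (singularHomology.map R M (ContinuousMap.id X) k)
    rw [singularHomology.map_id]
    infer_instance
  change IsIso (HomologicalComplex.homologyMap φ.τ₃ n)
  haveI := hτ₂ n
  exact HomologicalComplex.HomologySequence.isIso_homologyMap_τ₃ φ hS₁ hS₂ n inferInstance
    (hτ₂ n) (fun j _ ↦ hτ₁ j) (fun j _ ↦ inferInstance)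

lemma restrictToPoint_restrictLocal_apply {K L : Set X} (h : L ⊆ K) {y : X} (hy : y ∈ L) (n : ℕ)
    (a : localHomologyOfSet R M X K n) :
    restrictToPoint R M hy n (restrictLocal R M h n a) = restrictToPoint R M (h hy) n a := by
  rw [restrictToPoint, restrictToPoint, ← ModuleCat.comp_apply, restrictLocal_comp]

namespace HomologicalOrientation

variable {R} {n : ℕ}

theorem exists_isUnit_smul (μ ν : HomologicalOrientation R X n) (x : X) :
    ∃ u : R, IsUnit u ∧ μ.localClass x = u • ν.localClass x := by
  obtain ⟨e, he⟩ := ν.isGenerator x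
  obtain ⟨e', he'⟩ := μ.isGenerator x
  refine ⟨e (μ.localClass x), ?_, ?_⟩
  · let f : R ≃ₗ[R] R := e'.symm.trans e
    have hf : ∀ r, f r = r * f 1 := fun r ↦ by
      rw [← smul_eq_mul, ← map_smul, smul_eq_mul, mul_one]
    have h1 : f 1 = e (μ.localClass x) := by
      simp only [f, LinearEquiv.trans_apply, ← he', LinearEquiv.symm_apply_apply]
    refine IsUnit.of_mul_eq_one (f.symm 1) ?_
    rw [← h1, mul_comm, ← hf, LinearEquiv.apply_symm_apply]
  · apply e.injective
    rw [map_smul, he, smul_eq_mul, mul_one]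

end HomologicalOrientation

section Radial

variable {E : Type*} [NormedAddCommGroup E] [NormedSpace ℝ E]

def radialDeformation (p : E) (r t : ℝ) (v : E) : E :=
  p + ((1 - t) * (r / ‖v - p‖) + t) • (v - p)

lemma radialDeformation_sub (p : E) (r t : ℝ) (v : E) :
    radialDeformation p r t v - p = ((1 - t) * (r / ‖v - p‖) + t) • (v - p) :=
  add_sub_cancel_left _ _

lemma radialDeformation_of_norm_eq {p : E} {r : ℝ} (hr : r ≠ 0) (t : ℝ) {v : E}
    (hv : ‖v - p‖ = r) : radialDeformation p r t v = v := by
  rw [radialDeformation, hv, div_self hr, mul_one, sub_add_cancel, one_smul, add_sub_cancel]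

lemma radialDeformation_one (p : E) (r : ℝ) (v : E) : radialDeformation p r 1 v = v := by
  simp [radialDeformation]

lemma norm_radialDeformation_sub {p : E} {r t : ℝ} {v : E} (ht₀ : 0 ≤ t) (ht₁ : t ≤ 1)
    (hv : v ≠ p) (hvr : ‖v - p‖ ≤ r) :
    ‖radialDeformation p r t v - p‖ = (1 - t) * r + t * ‖v - p‖ := by
  have hd : 0 < ‖v - p‖ := norm_pos_iff.2 (sub_ne_zero.2 hv)
  rw [radialDeformation_sub, norm_smul, Real.norm_of_nonneg, add_mul, mul_assoc,
    div_mul_cancel₀ _ hd.ne']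
  exact add_nonneg (mul_nonneg (sub_nonneg.2 ht₁) (div_nonneg (hd.le.trans hvr) hd.le)) ht₀

lemma norm_radialDeformation_sub_le {p : E} {r t : ℝ} {v : E} (ht₀ : 0 ≤ t) (ht₁ : t ≤ 1)
    (hv : v ≠ p) (hvr : ‖v - p‖ ≤ r) : ‖radialDeformation p r t v - p‖ ≤ r := by
  rw [norm_radialDeformation_sub ht₀ ht₁ hv hvr]
  nlinarith

lemma le_norm_radialDeformation_sub {p : E} {r t : ℝ} {v : E} (ht₀ : 0 ≤ t) (ht₁ : t ≤ 1)
    (hv : v ≠ p) (hvr : ‖v - p‖ ≤ r) : ‖v - p‖ ≤ ‖radialDeformation p r t v - p‖ := by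
  rw [norm_radialDeformation_sub ht₀ ht₁ hv hvr]
  nlinarith

lemma radialDeformation_ne {p : E} {r t : ℝ} {v : E} (ht₀ : 0 ≤ t) (ht₁ : t ≤ 1)
    (hv : v ≠ p) (hvr : ‖v - p‖ ≤ r) : radialDeformation p r t v ≠ p := by
  intro h
  have := le_norm_radialDeformation_sub ht₀ ht₁ hv hvr
  rw [h, sub_self, norm_zero, norm_le_zero_iff, sub_eq_zero] at this
  exact hv this

lemma continuousOn_radialDeformation (p : E) (r : ℝ) :
    ContinuousOn (fun z : ℝ × E ↦ radialDeformation p r z.1 z.2) {z | z.2 ≠ p} := by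
  refine continuousOn_const.add (ContinuousOn.smul ?_ (continuousOn_snd.sub continuousOn_const))
  refine (((continuousOn_const.sub continuousOn_fst).mul (continuousOn_const.div
    (continuousOn_snd.sub continuousOn_const).norm ?_)).add continuousOn_fst)
  exact fun z hz ↦ (norm_pos_iff.2 (sub_ne_zero.2 hz)).ne'

end Radial

section ChartBall

variable [T2Space X] (E : Type*) [NormedAddCommGroup E] [NormedSpace ℝ E] [ProperSpace E]
  [ChartedSpace E X]

include E

theorem exists_isOpen_retract_compl (x : X) {U : Set X} (hU : U ∈ 𝓝 x) :
    ∃ B : Set X, ∃ hxB : x ∈ B, IsOpen B ∧ B ⊆ U ∧ ∃ ρ : C(({x}ᶜ : Set X), (Bᶜ : Set X)),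
      ρ.comp (complInclusion (Set.singleton_subset_iff.2 hxB)) = ContinuousMap.id _ ∧
      ((complInclusion (Set.singleton_subset_iff.2 hxB)).comp ρ).Homotopic
        (ContinuousMap.id _) := by
  classical
  set c := chartAt E x with hc
  set p : E := c x with hp
  have hxc : x ∈ c.source := mem_chart_source E x
  have hpt : p ∈ c.target := mem_chart_target E x
  have hW : c.target ∩ c.symm ⁻¹' U ∈ 𝓝 p :=
    Filter.inter_mem (chart_target_mem_nhds E x)
      ((c.continuousAt_symm hpt).preimage_mem_nhds (by rwa [c.left_inv hxc]))
  obtain ⟨r, hr, hrW⟩ := Metric.nhds_basis_closedBall.mem_iff.1 hW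
  have hrt : Metric.closedBall p r ⊆ c.target := hrW.trans Set.inter_subset_left
  have hrU : ∀ v ∈ Metric.closedBall p r, c.symm v ∈ U := fun v hv ↦ (hrW hv).2
  set B := c.source ∩ c ⁻¹' Metric.ball p r with hB
  set D := c.source ∩ c ⁻¹' Metric.closedBall p r with hD
  have hBo : IsOpen B := c.isOpen_inter_preimage Metric.isOpen_ball
  have hxB : x ∈ B := ⟨hxc, Metric.mem_ball_self hr⟩
  have hBD : B ⊆ D := fun y hy ↦ ⟨hy.1, Metric.ball_subset_closedBall hy.2⟩
  have hDc : IsClosed D := by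
    rw [hD, ← c.symm_image_eq_source_inter_preimage hrt]
    exact ((isCompact_closedBall p r).image_of_continuousOn
      (c.continuousOn_symm.mono hrt)).isClosed
  have hnorm : ∀ y ∈ D, ‖c y - p‖ ≤ r := fun y hy ↦ by
    rw [← dist_eq_norm]; exact hy.2
  have hne : ∀ y ∈ D, y ≠ x → c y ≠ p := fun y hy hyx h ↦ hyx (c.injOn hy.1 hxc h)
  have hsphere : ∀ y ∈ D, y ∉ B → ‖c y - p‖ = r := fun y hy hyB ↦
    le_antisymm (hnorm y hy) (by
      rw [← dist_eq_norm]; exact not_lt.1 fun h ↦ hyB ⟨hy.1, h⟩)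

  let F : I × X → X := fun z ↦
    if z.2 ∈ D then c.symm (radialDeformation p r z.1 (c z.2)) else z.2
  have hFD : ∀ (t : I) (y : X), y ∈ D → F (t, y) = c.symm (radialDeformation p r t (c y)) :=
    fun t y hy ↦ if_pos hy
  have hFD' : ∀ (t : I) (y : X), y ∉ D → F (t, y) = y := fun t y hy ↦ if_neg hy
  have hmem : ∀ (t : I), ∀ y ∈ D, y ≠ x →
      radialDeformation p r t (c y) ∈ Metric.closedBall p r := fun t y hy hyx ↦ by
    rw [Metric.mem_closedBall, dist_eq_norm]
    exact norm_radialDeformation_sub_le t.2.1 t.2.2 (hne y hy hyx) (hnorm y hy)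
  have hFx : ∀ (t : I) (y : X), y ≠ x → F (t, y) ≠ x := by
    intro t y hyx
    by_cases hy : y ∈ D
    · rw [hFD t y hy]
      intro h
      have := congrArg c h
      rw [c.right_inv (hrt (hmem t y hy hyx))] at this
      exact radialDeformation_ne t.2.1 t.2.2 (hne y hy hyx) (hnorm y hy) this
    · rwa [hFD' t y hy]
  have hF0 : ∀ y : X, y ≠ x → F (0, y) ∉ B := by
    intro y hyx
    by_cases hy : y ∈ D
    · rw [hFD 0 y hy]
      rintro ⟨-, h⟩
      rw [Set.mem_preimage, c.right_inv (hrt (hmem 0 y hy hyx)), Metric.mem_ball, dist_eq_norm,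
        norm_radialDeformation_sub (t := ((0 : I) : ℝ)) le_rfl zero_le_one (hne y hy hyx)
          (hnorm y hy)] at h
      simp at h
    · rw [hFD' 0 y hy]
      exact fun h ↦ hy (hBD h)
  have hF0' : ∀ y : X, y ∉ B → F (0, y) = y := by
    intro y hyB
    by_cases hy : y ∈ D
    · rw [hFD 0 y hy, radialDeformation_of_norm_eq hr.ne' _ (hsphere y hy hyB), c.left_inv hy.1]
    · exact hFD' 0 y hy
  have hF1 : ∀ y : X, F (1, y) = y := by
    intro y
    by_cases hy : y ∈ D
    · rw [hFD 1 y hy, Set.Icc.coe_one, radialDeformation_one, c.left_inv hy.1]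
    · exact hFD' 1 y hy
  have hFc : ContinuousOn F {z | z.2 ≠ x} := by
    apply ContinuousOn.if
    · rintro ⟨t, y⟩ ⟨hyx : y ≠ x, hfr⟩
      have hyD : y ∈ D := frontier_subset_iff_isClosed.2 (hDc.preimage continuous_snd) hfr
      have hyB : y ∉ B := fun h ↦
        hfr.2 (interior_maximal (s := {a : I × X | a.2 ∈ D}) (t := Prod.snd ⁻¹' B)
          (fun z hz ↦ hBD hz) (hBo.preimage continuous_snd) h)
      simp only
      rw [radialDeformation_of_norm_eq hr.ne' _ (hsphere y hyD hyB), c.left_inv hyD.1]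
    · have hcl : closure {a : I × X | a.2 ∈ D} = {a | a.2 ∈ D} :=
        (hDc.preimage continuous_snd).closure_eq
      rw [hcl]
      refine c.continuousOn_symm.comp ((continuousOn_radialDeformation p r).comp
        ((continuous_subtype_val.comp continuous_fst).continuousOn.prodMk
          (c.continuousOn.comp continuousOn_snd fun z hz ↦ hz.2.1)) ?_) ?_
      · exact fun z hz ↦ hne z.2 hz.2 hz.1
      · exact fun z hz ↦ hrt (hmem z.1 z.2 hz.2 hz.1)
    · exact continuousOn_snd

  refine ⟨B, hxB, hBo, fun y hy ↦ ?_, ?_⟩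
  · have := hrU (c y) (Metric.ball_subset_closedBall hy.2)
    rwa [c.left_inv hy.1] at this
  let ρ : C(({x}ᶜ : Set X), (Bᶜ : Set X)) :=
    ⟨fun y ↦ ⟨F (0, y), hF0 y y.2⟩,
      (hFc.comp_continuous (continuous_const.prodMk continuous_subtype_val)
        fun y ↦ y.2).subtype_mk _⟩
  refine ⟨ρ, ContinuousMap.ext fun y ↦ Subtype.ext (hF0' y y.2), ⟨?_⟩⟩
  exact
    { toFun := fun z ↦ ⟨F (z.1, z.2), hFx z.1 z.2 z.2.2⟩
      continuous_toFun := (hFc.comp_continuous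
        (continuous_fst.prodMk (continuous_subtype_val.comp continuous_snd))
        fun z ↦ z.2.2).subtype_mk _
      map_zero_left := fun y ↦ rfl
      map_one_left := fun y ↦ Subtype.ext (hF1 y) }

theorem exists_isOpen_isIso_restrictToPoint (x : X) {U : Set X} (hU : U ∈ 𝓝 x) :
    ∃ B : Set X, ∃ hxB : x ∈ B, IsOpen B ∧ B ⊆ U ∧ ∀ k, IsIso (restrictToPoint R M hxB k) := by
  obtain ⟨B, hxB, hBo, hBU, ρ, h₁, h₂⟩ := exists_isOpen_retract_compl E x hU
  exact ⟨B, hxB, hBo, hBU, fun k ↦ isIso_restrictLocal_of_retract R M _ ρ h₁ h₂ k⟩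

end ChartBall

namespace HomologicalOrientation

variable {R} {n : ℕ}

theorem eventually_eq_smul [T2Space X] [ChartedSpace (EuclideanSpace ℝ (Fin n)) X]
    (μ ν : HomologicalOrientation R X n) {x : X} {u : R}
    (h : μ.localClass x = u • ν.localClass x) :
    ∀ᶠ y in 𝓝 x, μ.localClass y = u • ν.localClass y := by
  obtain ⟨K, hK, μK, hμK⟩ := μ.locallyConsistent x
  obtain ⟨K', hK', νK, hνK⟩ := ν.locallyConsistent x
  obtain ⟨B, hxB, hBo, hBU, hiso⟩ :=
    exists_isOpen_isIso_restrictToPoint R R (EuclideanSpace ℝ (Fin n)) x (Filter.inter_mem hK hK')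
  have hBK : B ⊆ K := hBU.trans Set.inter_subset_left
  have hBK' : B ⊆ K' := hBU.trans Set.inter_subset_right
  have key : restrictLocal R R hBK n μK = u • restrictLocal R R hBK' n νK := by
    haveI := hiso n
    apply (ModuleCat.mono_iff_injective (restrictToPoint R R hxB n)).1 inferInstance
    rw [map_smul, restrictToPoint_restrictLocal_apply, restrictToPoint_restrictLocal_apply,
      hμK x (hBK hxB), hνK x (hBK' hxB), h]
  filter_upwards [hBo.mem_nhds hxB] with y hy
  rw [← hμK y (hBK hy), ← hνK y (hBK' hy), ← restrictToPoint_restrictLocal_apply R R hBK hy,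
    ← restrictToPoint_restrictLocal_apply R R hBK' hy, key, map_smul]

lemma eq_one_of_smul_eq (ν : HomologicalOrientation R X n) (y : X) {u : R}
    (h : u • ν.localClass y = ν.localClass y) : u = 1 := by
  obtain ⟨e, he⟩ := ν.isGenerator y
  have := congrArg e h
  rwa [map_smul, he, smul_eq_mul, mul_one] at this

variable (R X) in

theorem ext_of_connected_holds : HomologicalOrientation.ext_of_connected R (X := X) := by
  intro n _ _ _ μ ν x h
  let S : Set X := {y | μ.localClass y = ν.localClass y}
  have hSo : IsOpen S := isOpen_iff_mem_nhds.2 fun y (hy : μ.localClass y = ν.localClass y) ↦ by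
    have := eventually_eq_smul μ ν (u := 1) (by rw [one_smul]; exact hy)
    filter_upwards [this] with z hz
    rw [one_smul] at hz
    exact hz
  have hSc : IsClosed S := by
    rw [← isOpen_compl_iff, isOpen_iff_mem_nhds]
    intro y hy
    obtain ⟨u, -, hyu⟩ := exists_isUnit_smul μ ν y
    filter_upwards [eventually_eq_smul μ ν hyu] with z hz (hz' : μ.localClass z = ν.localClass z)
    have hu : u = 1 := eq_one_of_smul_eq ν z (hz.symm.trans hz')
    exact hy (show μ.localClass y = ν.localClass y by rw [hyu, hu, one_smul])
  have hS : S = Set.univ :=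
    (isClopen_iff.1 ⟨hSc, hSo⟩).resolve_left (Set.nonempty_iff_ne_empty.1 ⟨x, h⟩)
  ext1
  funext y
  exact (Set.eq_univ_iff_forall.1 hS y : μ.localClass y = ν.localClass y)

theorem eq_or_eq_neg_of_isUnit_imp [T2Space X] [ChartedSpace (EuclideanSpace ℝ (Fin n)) X]
    [ConnectedSpace X] (hR : ∀ u : R, IsUnit u → u = 1 ∨ u = -1)
    (μ ν : HomologicalOrientation R X n) : μ = ν ∨ μ = -ν := by
  rcases isEmpty_or_nonempty X with hX | ⟨⟨x⟩⟩
  · exact Or.inl (HomologicalOrientation.ext (funext fun x ↦ isEmptyElim x))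
  obtain ⟨u, hu, hxu⟩ := exists_isUnit_smul μ ν x
  rcases hR u hu with rfl | rfl
  · exact Or.inl (ext_of_connected_holds R X μ ν x (by rw [hxu, one_smul]))
  · exact Or.inr (ext_of_connected_holds R X μ (-ν) x (by rw [hxu, neg_one_smul, neg_localClass]))

variable (X) in

theorem eq_or_eq_neg_of_connected_holds :
    HomologicalOrientation.eq_or_eq_neg_of_connected (X := X) :=
  fun μ ν ↦ eq_or_eq_neg_of_isUnit_imp (fun _ hu ↦ Int.isUnit_iff.1 hu) μ ν

end HomologicalOrientation

end HostAPI.Carriers.AlgebraicTopology.SingularHomology
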